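import Summits.QuantumFields.QCD.Theses.WilsonQuarkChessboard
import Summits.QuantumFields.QCD.Theorems.WilsonQuarkChessboardQuarkChessboard
import Summits.QuantumFields.QCD.Theorems.QuarksAsStableActionWilsonQuarkStabilityStubNormDetChainBlock
import Summits.QuantumFields.QCD.Theorems.WilsonQuarkChessboardFlatCellOptimalStubCyclicHolderEven
import Summits.QuantumFields.QCD.Theorems.WilsonQuarkChessboardFlatCellOptimalStubStaticSliceBoundAllN
import Summits.QuantumFields.QCD.Theorems.WilsonQuarkChessboardFlatCellOptimalStubStaticIterateAllN

/-!
# `WilsonQuarkChessboard.FlatCellOptimal` and `WilsonQuarkChessboard.QuarkDiamagnetism`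
(route WilsonQuarkChessboard, sub-problem QCD; items stmt-QuantumFields-9307 — crux K, line `registered`,
lead prover-line-stmt-QuantumFields-9307-c1-0 — and stmt-QuantumFields-9310)

**Theorem (`diamagnetic_even`, the diamagnetic inequality for `r = 1` Wilson fermions on even tori).**  For every
colour number `N`, every even side `L`, every `U(N)` link field `V` on `(ℤ/L)⁴` and every bare mass `m > −1`,
`‖det D_W[V]‖ ≤ ‖det D_W[T]‖`, where `T` is the all-seams antiperiodic pattern (`−1` on the links leaving the slices
`x_μ = −1`, `1` elsewhere), i.e. `det D_W[T]` is the free determinant with antiperiodic quarks on all four axes.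

Mechanism — Fröhlich–Israel–Lieb–Simon Gaussian domination through BOND reflections, in Lüscher's transfer-matrix
language (the method of Lieb's flux-phase theorem; for `r = 1` Wilson quarks with antiperiodic boundary conditions the
extremal "flux" is ZERO flux): Lüscher's form `det D_W[V] = (∏_t det E_t) · det(1 − ∏_{t<L} M_t W_t)`
(`wilson_det_transfer_form`, any `N`, any `L`), the Fock functor `Tr Γ(X) = det (1 + X)`, the generalised Hölder
inequality for Schatten norms with `L` equal exponents — in which the unitary temporal transporters `W_t` drop out —
give the static slice bound `‖det D_W[V]‖^L ≤ ∏_s ‖det D_W[S⁰_s V]‖` (`stub_staticSliceBoundAllN`, with the even-`L`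
Hölder step `stub_cyclicHolderEven` from `evenCycleChessboard` and the chain-block lemma `stub_normDetChainBlock`),
and four axes in turn collapse every field onto `T` (`stub_staticIterateAllN`).  The odd-`L`, `U(3)` twin is the tree
theorem `diamagnetic_odd` (crux 9736).

**Corollaries.**  With `δ = 1`: `QuarkDiamagnetism` (`‖det_AP[U]‖ ≤ Re det_AP[𝟙]` for even `L ≥ 4`, `|m| < 1`; the
free antiperiodic determinant is real `≥ 0` for `m > −1` by the proved `QuarkChessboard` at `U = 1`) and the crux
`FlatCellOptimal` (`Re det_AP[R_c U] ≤ Re det_AP[𝟙]` for every period-2 reflection tiling — indeed for every field).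
Pure theorem file (no definitions), kernel-clean.
References: M. Lüscher, Commun. Math. Phys. 54 (1977) 283; J. Fröhlich, R. Israel, E. H. Lieb, B. Simon, Commun. Math.
Phys. 62 (1978) 1, Thm. 4.1; E. H. Lieb, Phys. Rev. Lett. 73 (1994) 2158; I. Montvay, G. Münster, *Quantum Fields on a
Lattice* §4.2.3 (link-reflection positivity of Wilson fermions, every `K`, `|r| ≤ 1`).
-/

noncomputable section

open scoped ComplexOrder
open Literature.MathematicalPhysics.QuantumLattice Literature.MathematicalPhysics.QuantumFieldTheory

namespace Summit.QuantumFields.QCD.Theorems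

namespace FlatCellOptimalDiamag

/-- **The diamagnetic inequality on even tori** (every `N`, every even `L`, every `m > −1`): the `r = 1` Wilson–Dirac
determinant of every `U(N)` link field is dominated in modulus by that of the all-seams antiperiodic pattern. -/
theorem diamagnetic_even (N L : ℕ) [NeZero L] (hL : Even L)
    (V : GaugeConfig 4 L (Matrix.unitaryGroup (Fin N) ℂ)) (m : ℝ) (hm : -1 < m) :
    ‖(wilsonDirac (unitaryFundamentalRep (Fin N) ℂ) V m 1).det‖ ≤
      ‖(wilsonDirac (unitaryFundamentalRep (Fin N) ℂ)
        (fun e : Edge 4 L => if e.1 e.2 = -1 then (-1 : Matrix.unitaryGroup (Fin N) ℂ) else 1) m 1).det‖ := by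
  refine Summit.QuantumFields.QCD.Cruxes.FlatCellOptimal.Diamag.stub_staticIterateAllN N L ?_ V m hm
  intro W m' hm'
  refine Summit.QuantumFields.QCD.Cruxes.FlatCellOptimal.Diamag.stub_staticSliceBoundAllN N L ?_ ?_ W m' hm'
  · intro k _ _ T u hT hu
    exact Summit.QuantumFields.QCD.Cruxes.FlatCellOptimal.Diamag.stub_cyclicHolderEven L hL T u hT hu
  · intro k _ _ A Pp Pm W' h1 h2 h3 h4 h5 h6 h7 h8
    exact Summit.QuantumFields.QCD.Cruxes.WilsonQuarkStability.FreeTangentLandauChessboard.stub_normDetChainBlock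
      A Pp Pm W' h1 h2 h3 h4 h5 h6 h7 h8

/-- Seam convention: on `ZMod L` (`L ≠ 0`), `x.val + 1 = L ↔ x = -1`. -/
theorem zmod_val_add_one_eq_iff {L : ℕ} [NeZero L] (x : ZMod L) : x.val + 1 = L ↔ x = -1 := by
  obtain ⟨n, hn⟩ : ∃ n, L = n + 1 := Nat.exists_eq_succ_of_ne_zero (NeZero.ne L)
  subst hn
  constructor
  · intro h
    have h1 : ((x.val + 1 : ℕ) : ZMod (n + 1)) = 0 := by
      rw [h]
      exact ZMod.natCast_self _
    rw [Nat.cast_add, Nat.cast_one, ZMod.natCast_zmod_val] at h1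
    exact eq_neg_of_add_eq_zero_left h1
  · rintro rfl
    rw [ZMod.val_neg_one]

/-- The route's antiperiodic twist of a field, written with the seam `x_μ = −1`. -/
theorem apTwist_eq {N L : ℕ} [NeZero L] (V : GaugeConfig 4 L (Matrix.unitaryGroup (Fin N) ℂ)) :
    (fun e : Edge 4 L => if (e.1 e.2).val + 1 = L then -V e else V e) =
      (fun e : Edge 4 L => if e.1 e.2 = -1 then -V e else V e) := by
  funext e
  by_cases h : e.1 e.2 = -1
  · rw [if_pos h, if_pos ((zmod_val_add_one_eq_iff _).2 h)]
  · rw [if_neg h, if_neg (fun h' => h ((zmod_val_add_one_eq_iff _).1 h'))]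

/-- The route's antiperiodically twisted unit field IS the all-seams pattern of `diamagnetic_even`. -/
theorem apTwist_one_eq {N L : ℕ} [NeZero L] :
    (fun e : Edge 4 L => if (e.1 e.2).val + 1 = L then -(1 : GaugeConfig 4 L (Matrix.unitaryGroup (Fin N) ℂ)) e
      else (1 : GaugeConfig 4 L (Matrix.unitaryGroup (Fin N) ℂ)) e) =
    (fun e : Edge 4 L => if e.1 e.2 = -1 then (-1 : Matrix.unitaryGroup (Fin N) ℂ) else 1) := by
  rw [apTwist_eq]
  rfl

/-- **Diamagnetism in the route's currency**: `‖det_AP[V]‖ ≤ ‖det_AP[𝟙]‖` for EVERY field `V` (even `L`, `m > −1`). -/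
theorem norm_apDet_le {N L : ℕ} [NeZero L] (hL : Even L) {m : ℝ} (hm : -1 < m)
    (V : GaugeConfig 4 L (Matrix.unitaryGroup (Fin N) ℂ)) :
    ‖(wilsonDirac (unitaryFundamentalRep (Fin N) ℂ)
        (fun e : Edge 4 L => if (e.1 e.2).val + 1 = L then -V e else V e) m 1).det‖ ≤
      ‖(wilsonDirac (unitaryFundamentalRep (Fin N) ℂ)
        (fun e : Edge 4 L => if (e.1 e.2).val + 1 = L then -(1 : GaugeConfig 4 L (Matrix.unitaryGroup (Fin N) ℂ)) e
          else (1 : GaugeConfig 4 L (Matrix.unitaryGroup (Fin N) ℂ)) e) m 1).det‖ := by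
  rw [apTwist_one_eq]
  exact diamagnetic_even N L hL _ m hm

/-- The free antiperiodic determinant is real and `≥ 0` for `m > −1` (the proved `QuarkChessboard` at `U = 1`, whose
tiling is `1`), hence its norm is its real part. -/
theorem norm_apDet_one_eq_re {N L : ℕ} [NeZero L] (hL : Even L) (h4 : 4 ≤ L) {m : ℝ} (hm : -1 < m) :
    ‖(wilsonDirac (unitaryFundamentalRep (Fin N) ℂ)
        (fun e : Edge 4 L => if (e.1 e.2).val + 1 = L then -(1 : GaugeConfig 4 L (Matrix.unitaryGroup (Fin N) ℂ)) e
          else (1 : GaugeConfig 4 L (Matrix.unitaryGroup (Fin N) ℂ)) e) m 1).det‖ =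
      ((wilsonDirac (unitaryFundamentalRep (Fin N) ℂ)
        (fun e : Edge 4 L => if (e.1 e.2).val + 1 = L then -(1 : GaugeConfig 4 L (Matrix.unitaryGroup (Fin N) ℂ)) e
          else (1 : GaugeConfig 4 L (Matrix.unitaryGroup (Fin N) ℂ)) e) m 1).det).re := by
  have hQC := Summit.QuantumFields.QCD.Theorems.wilsonQuarkChessboardQuarkChessboard_proof N L hL h4
    (1 : GaugeConfig 4 L (Matrix.unitaryGroup (Fin N) ℂ)) m hm
  obtain ⟨hReal, -⟩ := hQC
  obtain ⟨hre, him⟩ := hReal (0 : Site 4 L)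
  have hre' : 0 ≤ (wilsonDirac (unitaryFundamentalRep (Fin N) ℂ)
      (fun e : Edge 4 L => if (e.1 e.2).val + 1 = L then (-1 : Matrix.unitaryGroup (Fin N) ℂ) else 1)
      m 1).det.re := by
    simpa using hre
  have him' : (wilsonDirac (unitaryFundamentalRep (Fin N) ℂ)
      (fun e : Edge 4 L => if (e.1 e.2).val + 1 = L then (-1 : Matrix.unitaryGroup (Fin N) ℂ) else 1)
      m 1).det.im = 0 := by
    simpa using him
  simp only [Pi.one_apply]
  set z : ℂ := (wilsonDirac (unitaryFundamentalRep (Fin N) ℂ)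
      (fun e : Edge 4 L => if (e.1 e.2).val + 1 = L then (-1 : Matrix.unitaryGroup (Fin N) ℂ) else 1)
      m 1).det with hz
  have hzeq : z = ((z.re : ℝ) : ℂ) := Complex.ext (by simp) (by simp [him'])
  rw [hzeq]
  simp [abs_of_nonneg hre']

/-- `‖det_AP[V]‖ ≤ Re det_AP[𝟙]` for every field (even `L ≥ 4`, `m > −1`). -/
theorem norm_apDet_le_re {N L : ℕ} [NeZero L] (hL : Even L) (h4 : 4 ≤ L) {m : ℝ} (hm : -1 < m)
    (V : GaugeConfig 4 L (Matrix.unitaryGroup (Fin N) ℂ)) :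
    ‖(wilsonDirac (unitaryFundamentalRep (Fin N) ℂ)
        (fun e : Edge 4 L => if (e.1 e.2).val + 1 = L then -V e else V e) m 1).det‖ ≤
      ((wilsonDirac (unitaryFundamentalRep (Fin N) ℂ)
        (fun e : Edge 4 L => if (e.1 e.2).val + 1 = L then -(1 : GaugeConfig 4 L (Matrix.unitaryGroup (Fin N) ℂ)) e
          else (1 : GaugeConfig 4 L (Matrix.unitaryGroup (Fin N) ℂ)) e) m 1).det).re :=
  (norm_apDet_le hL hm V).trans_eq (norm_apDet_one_eq_re hL h4 hm)

/-- `Re det_AP[V] ≤ Re det_AP[𝟙]` for every field (even `L ≥ 4`, `m > −1`) — K for every cell, flat or not. -/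
theorem re_apDet_le_re {N L : ℕ} [NeZero L] (hL : Even L) (h4 : 4 ≤ L) {m : ℝ} (hm : -1 < m)
    (V : GaugeConfig 4 L (Matrix.unitaryGroup (Fin N) ℂ)) :
    ((wilsonDirac (unitaryFundamentalRep (Fin N) ℂ)
        (fun e : Edge 4 L => if (e.1 e.2).val + 1 = L then -V e else V e) m 1).det).re ≤
      ((wilsonDirac (unitaryFundamentalRep (Fin N) ℂ)
        (fun e : Edge 4 L => if (e.1 e.2).val + 1 = L then -(1 : GaugeConfig 4 L (Matrix.unitaryGroup (Fin N) ℂ)) e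
          else (1 : GaugeConfig 4 L (Matrix.unitaryGroup (Fin N) ℂ)) e) m 1).det).re :=
  (Complex.re_le_norm _).trans (norm_apDet_le_re hL h4 hm V)

end FlatCellOptimalDiamag

/-- **`WilsonQuarkChessboard.QuarkDiamagnetism`** (item stmt-QuantumFields-9310) with `δ = 1`: for every `N`, every
even `L ≥ 4`, every `U(N)` field `U` and `|m| < 1`, `‖det_AP[U]‖ ≤ Re det_AP[𝟙]`. -/
theorem wilsonQuarkChessboardQuarkDiamagnetism_proof :
    Summit.QuantumFields.QCD.Theses.WilsonQuarkChessboard.QuarkDiamagnetism := by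
  refine ⟨1, one_pos, ?_⟩
  intro N L _ hL h4 U m hm₁ _
  exact FlatCellOptimalDiamag.norm_apDet_le_re hL h4 (by linarith) U

/-- **`WilsonQuarkChessboard.FlatCellOptimal`** (crux K, item stmt-QuantumFields-9307) with `δ = 1`: for every `N`,
every even `L ≥ 4`, every `U(N)` field `U`, every corner `c` and `|m| < 1`, `Re det_AP[R_c U] ≤ Re det_AP[𝟙]` — the flat
cell maximises the antiperiodic Wilson determinant among the period-2 reflection tilings (indeed among all fields). -/
theorem wilsonQuarkChessboardFlatCellOptimal_proof :
    Summit.QuantumFields.QCD.Theses.WilsonQuarkChessboard.FlatCellOptimal := by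
  refine ⟨1, one_pos, ?_⟩
  intro N L _ hL h4 U c m hm₁ _
  exact FlatCellOptimalDiamag.re_apDet_le_re hL h4 (by linarith) _

end Summit.QuantumFields.QCD.Theorems

end
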